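import Summits.Ventures.Crystal3D.Theorems.StickyWulffConstantCoaxialWallLawTwinAbsorptionMoved
import Summits.Ventures.Crystal3D.Theorems.StickyWulffConstantCoaxialWallLawInPlaneSix
import Summits.Ventures.Crystal3D.Theorems.StickyWulffConstantCoaxialWallLawRiserCountTop
import Literature.MathematicalPhysics.StatisticalMechanics.WulffCrystalGammaLimit
import HarnessLib

/-!
# The twin-pair slot ledger: in-plane vacancies of both grains are bounded by `8·D(X)`

HONEST FRAMING. Part of the venture `Summits/Ventures/Crystal3D` (cell `crystal3d-full`), helper
`--supports` the crux `CoaxialWallLaw` (stmt-Ventures-19481, `route-Ventures-StickyWulffConstant`),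
REGISTERED line `WallLedgerF` (planner cf-p1 gen 16), stub `stub_coaxialTwoSlabAdhesion`
(terrace/riser slot ledger, RIGID rung).  Sums the crude absorption inequality
(`twin_absorption_inPlane_moved` / `_moved'`) over the balls of each grain of a TWIN pair
`M·Λ₀ + t`, `(M ∘ R)·Λ₀ + t'` (grains disjoint, every ball on one of them):

**Theorem (`twin_inPlane_vacancies_le_eight_deficiency`).**  The twelve riser-count terms — for
each grain, the number of its balls whose slot `± M u`, `± M v`, `± M (v − u)` is vacant — add up
to at most `8 · contactDeficiency X`.

With the riser counts `coaxial_inPlane_vacancies` / `coaxial_inPlane_vacancies_top` (each grain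
contributes `≥ √6 sin θ · πρ² − C(1+h)ρ` to the left side) this is the wall term of the rigid
twin rung for DISJOINT (non-CSL) grains, `coaxial_rigid_twin_wall_term`:
`D(X) ≥ (√6/4) sin θ · πρ² − C(1+h)ρ` under the crux's literal hypotheses (twin word pair,
`X ⊆ Λ₁ ∪ Λ₂`), `√6/4 = 0.61 ≥ ½`; the outer-face credit and the cell bookkeeping of the stub
are not in this file.
WHAT THIS IS NOT: coincidence sites (CSL twins), translation pairs, outer faces, the stub; rung
F-C1 not moved.
-/

noncomputable section

namespace Summit.Ventures.Crystal3D.Theorems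

open Summit.Ventures.Crystal3D Finset
open Literature.MathematicalPhysics.StatisticalMechanics (fccStacking barlowStacking IsHaggSeq
  contactDeficiency orderedContacts triangularVec₁ triangularVec₂ sum_card_filter_dist_eq_orderedContacts)
open scoped InnerProductSpace

/-- Per-ball in-plane vacancy count of a host site `x` (host slots `x + N w`) as the six riser-count
indicators. -/
theorem inPlane_filter_card_eq_six (N : EuclideanSpace ℝ (Fin 3) ≃ₗᵢ[ℝ] EuclideanSpace ℝ (Fin 3))
    (X : Finset (EuclideanSpace ℝ (Fin 3))) (x : EuclideanSpace ℝ (Fin 3)) :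
    ((fccSlots.filter fun w => w 2 = 0 ∧ x + N w ∉ X).card : ℕ) =
      (if x + N (triangularVec₁ 1) ∉ X then 1 else 0) + (if x - N (triangularVec₁ 1) ∉ X then 1 else 0) +
      (if x + N (triangularVec₂ 1) ∉ X then 1 else 0) + (if x - N (triangularVec₂ 1) ∉ X then 1 else 0) +
      (if x + N (triangularVec₂ 1 - triangularVec₁ 1) ∉ X then 1 else 0) +
      (if x - N (triangularVec₂ 1 - triangularVec₁ 1) ∉ X then 1 else 0) := by
  classical
  rw [card_filter_fccSlots_horizontal (fun w => x + N w ∉ X)]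
  simp only [map_neg, ← sub_eq_add_neg]

/-- **The twin-pair slot ledger.**  See the module docstring. -/
theorem twin_inPlane_vacancies_le_eight_deficiency
    (M : EuclideanSpace ℝ (Fin 3) ≃ₗᵢ[ℝ] EuclideanSpace ℝ (Fin 3)) (t t' : EuclideanSpace ℝ (Fin 3))
    [DecidablePred fun p : EuclideanSpace ℝ (Fin 3) =>
      p ∈ (fun q => M q + t) '' fccStacking 1 (Real.sqrt (2 / 3))]
    [DecidablePred fun p : EuclideanSpace ℝ (Fin 3) =>
      p ∈ (fun q => ((ℝ ∙ EuclideanSpace.single (2 : Fin 3) (1 : ℝ)).reflection.trans M) q + t') ''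
        fccStacking 1 (Real.sqrt (2 / 3))]
    (X : Finset (EuclideanSpace ℝ (Fin 3)))
    (hX : ∀ p ∈ X, ∀ q ∈ X, p ≠ q → 1 ≤ dist p q)
    (hXΛ : ∀ p ∈ X, p ∈ (fun q => M q + t) '' fccStacking 1 (Real.sqrt (2 / 3)) ∨
      p ∈ (fun q => ((ℝ ∙ EuclideanSpace.single (2 : Fin 3) (1 : ℝ)).reflection.trans M) q + t') ''
        fccStacking 1 (Real.sqrt (2 / 3)))
    (hdisj : ∀ p ∈ (fun q => M q + t) '' fccStacking 1 (Real.sqrt (2 / 3)),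
      p ∉ (fun q => ((ℝ ∙ EuclideanSpace.single (2 : Fin 3) (1 : ℝ)).reflection.trans M) q + t') ''
        fccStacking 1 (Real.sqrt (2 / 3))) :
    ((((X.filter fun p => p ∈ (fun q => M q + t) '' fccStacking 1 (Real.sqrt (2 / 3))).filter
          fun p => p + M (triangularVec₁ 1) ∉ X).card : ℝ) +
      (((X.filter fun p => p ∈ (fun q => M q + t) '' fccStacking 1 (Real.sqrt (2 / 3))).filter
          fun p => p - M (triangularVec₁ 1) ∉ X).card : ℝ) +
      (((X.filter fun p => p ∈ (fun q => M q + t) '' fccStacking 1 (Real.sqrt (2 / 3))).filter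
          fun p => p + M (triangularVec₂ 1) ∉ X).card : ℝ) +
      (((X.filter fun p => p ∈ (fun q => M q + t) '' fccStacking 1 (Real.sqrt (2 / 3))).filter
          fun p => p - M (triangularVec₂ 1) ∉ X).card : ℝ) +
      (((X.filter fun p => p ∈ (fun q => M q + t) '' fccStacking 1 (Real.sqrt (2 / 3))).filter
          fun p => p + M (triangularVec₂ 1 - triangularVec₁ 1) ∉ X).card : ℝ) +
      (((X.filter fun p => p ∈ (fun q => M q + t) '' fccStacking 1 (Real.sqrt (2 / 3))).filter
          fun p => p - M (triangularVec₂ 1 - triangularVec₁ 1) ∉ X).card : ℝ)) +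
    ((((X.filter fun p => p ∈ (fun q => ((ℝ ∙ EuclideanSpace.single (2 : Fin 3) (1 : ℝ)).reflection.trans M) q + t') ''
          fccStacking 1 (Real.sqrt (2 / 3))).filter fun p => p + M (triangularVec₁ 1) ∉ X).card : ℝ) +
      (((X.filter fun p => p ∈ (fun q => ((ℝ ∙ EuclideanSpace.single (2 : Fin 3) (1 : ℝ)).reflection.trans M) q + t') ''
          fccStacking 1 (Real.sqrt (2 / 3))).filter fun p => p - M (triangularVec₁ 1) ∉ X).card : ℝ) +
      (((X.filter fun p => p ∈ (fun q => ((ℝ ∙ EuclideanSpace.single (2 : Fin 3) (1 : ℝ)).reflection.trans M) q + t') ''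
          fccStacking 1 (Real.sqrt (2 / 3))).filter fun p => p + M (triangularVec₂ 1) ∉ X).card : ℝ) +
      (((X.filter fun p => p ∈ (fun q => ((ℝ ∙ EuclideanSpace.single (2 : Fin 3) (1 : ℝ)).reflection.trans M) q + t') ''
          fccStacking 1 (Real.sqrt (2 / 3))).filter fun p => p - M (triangularVec₂ 1) ∉ X).card : ℝ) +
      (((X.filter fun p => p ∈ (fun q => ((ℝ ∙ EuclideanSpace.single (2 : Fin 3) (1 : ℝ)).reflection.trans M) q + t') ''
          fccStacking 1 (Real.sqrt (2 / 3))).filter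
          fun p => p + M (triangularVec₂ 1 - triangularVec₁ 1) ∉ X).card : ℝ) +
      (((X.filter fun p => p ∈ (fun q => ((ℝ ∙ EuclideanSpace.single (2 : Fin 3) (1 : ℝ)).reflection.trans M) q + t') ''
          fccStacking 1 (Real.sqrt (2 / 3))).filter
          fun p => p - M (triangularVec₂ 1 - triangularVec₁ 1) ∉ X).card : ℝ)) ≤
      8 * contactDeficiency X := by
  classical
  -- the half-turn negates the horizontal generators
  obtain ⟨hRu, hRv⟩ := halfTurn_triangularVec
  -- per-ball bounds
  have h₁ : ∀ x ∈ (X.filter fun p => p ∈ (fun q => M q + t) '' fccStacking 1 (Real.sqrt (2 / 3))),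
      ((if x + M (triangularVec₁ 1) ∉ X then 1 else 0) + (if x - M (triangularVec₁ 1) ∉ X then 1 else 0) +
      (if x + M (triangularVec₂ 1) ∉ X then 1 else 0) + (if x - M (triangularVec₂ 1) ∉ X then 1 else 0) +
      (if x + M (triangularVec₂ 1 - triangularVec₁ 1) ∉ X then 1 else 0) + (if x - M (triangularVec₂ 1 - triangularVec₁ 1) ∉ X then 1 else 0)) +
      4 * (X.filter fun y => dist x y = 1).card ≤ 48 := by
    intro x hx
    obtain ⟨-, hxG⟩ := mem_filter.1 hx
    rw [← inPlane_filter_card_eq_six M X x]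
    exact twin_absorption_inPlane_moved M t t' X hX hXΛ x hxG (hdisj x hxG)
  have h₂ : ∀ x ∈ (X.filter fun p => p ∈ (fun q => ((ℝ ∙ EuclideanSpace.single (2 : Fin 3) (1 : ℝ)).reflection.trans M) q + t') ''
        fccStacking 1 (Real.sqrt (2 / 3))),
      ((if x + M (triangularVec₁ 1) ∉ X then 1 else 0) + (if x - M (triangularVec₁ 1) ∉ X then 1 else 0) +
      (if x + M (triangularVec₂ 1) ∉ X then 1 else 0) + (if x - M (triangularVec₂ 1) ∉ X then 1 else 0) +
      (if x + M (triangularVec₂ 1 - triangularVec₁ 1) ∉ X then 1 else 0) + (if x - M (triangularVec₂ 1 - triangularVec₁ 1) ∉ X then 1 else 0)) +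
      4 * (X.filter fun y => dist x y = 1).card ≤ 48 := by
    intro x hx
    obtain ⟨-, hxG⟩ := mem_filter.1 hx
    have hxG₁ : x ∉ (fun q => M q + t) '' fccStacking 1 (Real.sqrt (2 / 3)) := fun h1 => hdisj x h1 hxG
    have key := twin_absorption_inPlane_moved' M t t' X hX hXΛ x hxG hxG₁
    rw [card_filter_fccSlots_horizontal
      (fun w => x + M ((ℝ ∙ EuclideanSpace.single (2 : Fin 3) (1 : ℝ)).reflection w) ∉ X)] at key
    beta_reduce at key
    -- the host slots of the twin grain are the same six vectors: `R u = −u`, `R v = −v`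
    have p1 : x + M ((ℝ ∙ EuclideanSpace.single (2 : Fin 3) (1 : ℝ)).reflection (triangularVec₁ 1)) = x - M (triangularVec₁ 1) := by
      rw [hRu, map_neg]; abel
    have p2 : x + M ((ℝ ∙ EuclideanSpace.single (2 : Fin 3) (1 : ℝ)).reflection (-triangularVec₁ 1)) =
        x + M (triangularVec₁ 1) := by
      rw [map_neg, hRu, neg_neg]
    have p3 : x + M ((ℝ ∙ EuclideanSpace.single (2 : Fin 3) (1 : ℝ)).reflection (triangularVec₂ 1)) = x - M (triangularVec₂ 1) := by
      rw [hRv, map_neg]; abel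
    have p4 : x + M ((ℝ ∙ EuclideanSpace.single (2 : Fin 3) (1 : ℝ)).reflection (-triangularVec₂ 1)) =
        x + M (triangularVec₂ 1) := by
      rw [map_neg, hRv, neg_neg]
    have p5 : x + M ((ℝ ∙ EuclideanSpace.single (2 : Fin 3) (1 : ℝ)).reflection (triangularVec₂ 1 - triangularVec₁ 1)) =
        x - M (triangularVec₂ 1 - triangularVec₁ 1) := by
      rw [map_sub, hRu, hRv, map_sub, map_sub, map_neg, map_neg]; abel
    have p6 : x + M ((ℝ ∙ EuclideanSpace.single (2 : Fin 3) (1 : ℝ)).reflection (-(triangularVec₂ 1 - triangularVec₁ 1))) =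
        x + M (triangularVec₂ 1 - triangularVec₁ 1) := by
      rw [map_neg, map_sub, hRu, hRv, map_neg, map_sub, map_sub, map_neg, map_neg]; abel
    rw [p1, p2, p3, p4, p5, p6] at key
    omega
  -- the two grains partition `X`
  have hunion : (X.filter fun p => p ∈ (fun q => M q + t) '' fccStacking 1 (Real.sqrt (2 / 3))) ∪ (X.filter fun p => p ∈ (fun q => ((ℝ ∙ EuclideanSpace.single (2 : Fin 3) (1 : ℝ)).reflection.trans M) q + t') ''
        fccStacking 1 (Real.sqrt (2 / 3))) = X := by
    ext p
    simp only [mem_union, mem_filter]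
    constructor
    · rintro (⟨hp, -⟩ | ⟨hp, -⟩) <;> exact hp
    · intro hp
      rcases hXΛ p hp with h | h
      · exact Or.inl ⟨hp, h⟩
      · exact Or.inr ⟨hp, h⟩
  have hdj : Disjoint (X.filter fun p => p ∈ (fun q => M q + t) '' fccStacking 1 (Real.sqrt (2 / 3))) (X.filter fun p => p ∈ (fun q => ((ℝ ∙ EuclideanSpace.single (2 : Fin 3) (1 : ℝ)).reflection.trans M) q + t') ''
        fccStacking 1 (Real.sqrt (2 / 3))) := by
    rw [disjoint_filter]
    exact fun p _ h1 h2 => hdisj p h1 h2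
  have hdeg : ∑ x ∈ X, (X.filter fun y => dist x y = 1).card = orderedContacts X :=
    sum_card_filter_dist_eq_orderedContacts X
  have hsum₁ := sum_le_sum h₁
  have hsum₂ := sum_le_sum h₂
  simp only [sum_add_distrib, sum_const, smul_eq_mul, ← card_filter] at hsum₁ hsum₂
  rw [← mul_sum] at hsum₁ hsum₂
  have hdeg' : ∑ x ∈ (X.filter fun p => p ∈ (fun q => M q + t) '' fccStacking 1 (Real.sqrt (2 / 3))), (X.filter fun y => dist x y = 1).card +
      ∑ x ∈ (X.filter fun p => p ∈ (fun q => ((ℝ ∙ EuclideanSpace.single (2 : Fin 3) (1 : ℝ)).reflection.trans M) q + t') ''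
        fccStacking 1 (Real.sqrt (2 / 3))), (X.filter fun y => dist x y = 1).card = orderedContacts X := by
    rw [← sum_union hdj, hunion, hdeg]
  have hcard : (X.filter fun p => p ∈ (fun q => M q + t) '' fccStacking 1 (Real.sqrt (2 / 3))).card + (X.filter fun p => p ∈ (fun q => ((ℝ ∙ EuclideanSpace.single (2 : Fin 3) (1 : ℝ)).reflection.trans M) q + t') ''
        fccStacking 1 (Real.sqrt (2 / 3))).card = X.card := by
    rw [← card_union_of_disjoint hdj, hunion]
  -- to the reals
  have hD : 8 * contactDeficiency X = 48 * (X.card : ℝ) - 4 * (orderedContacts X : ℝ) := by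
    rw [contactDeficiency]; ring
  rw [hD]
  have h1r : ((((X.filter fun p => p ∈ (fun q => M q + t) '' fccStacking 1 (Real.sqrt (2 / 3))).filter fun x => x + M (triangularVec₁ 1) ∉ X).card : ℕ) : ℝ) +
      ((((X.filter fun p => p ∈ (fun q => M q + t) '' fccStacking 1 (Real.sqrt (2 / 3))).filter fun x => x - M (triangularVec₁ 1) ∉ X).card : ℕ) : ℝ) +
      ((((X.filter fun p => p ∈ (fun q => M q + t) '' fccStacking 1 (Real.sqrt (2 / 3))).filter fun x => x + M (triangularVec₂ 1) ∉ X).card : ℕ) : ℝ) +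
      ((((X.filter fun p => p ∈ (fun q => M q + t) '' fccStacking 1 (Real.sqrt (2 / 3))).filter fun x => x - M (triangularVec₂ 1) ∉ X).card : ℕ) : ℝ) +
      ((((X.filter fun p => p ∈ (fun q => M q + t) '' fccStacking 1 (Real.sqrt (2 / 3))).filter fun x => x + M (triangularVec₂ 1 - triangularVec₁ 1) ∉ X).card : ℕ) : ℝ) +
      ((((X.filter fun p => p ∈ (fun q => M q + t) '' fccStacking 1 (Real.sqrt (2 / 3))).filter fun x => x - M (triangularVec₂ 1 - triangularVec₁ 1) ∉ X).card : ℕ) : ℝ) +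
      4 * ((∑ x ∈ (X.filter fun p => p ∈ (fun q => M q + t) '' fccStacking 1 (Real.sqrt (2 / 3))), (X.filter fun y => dist x y = 1).card : ℕ) : ℝ) ≤
      ((X.filter fun p => p ∈ (fun q => M q + t) '' fccStacking 1 (Real.sqrt (2 / 3))).card : ℝ) * 48 := by
    exact_mod_cast hsum₁
  have h2r : ((((X.filter fun p => p ∈ (fun q => ((ℝ ∙ EuclideanSpace.single (2 : Fin 3) (1 : ℝ)).reflection.trans M) q + t') ''
        fccStacking 1 (Real.sqrt (2 / 3))).filter fun x => x + M (triangularVec₁ 1) ∉ X).card : ℕ) : ℝ) +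
      ((((X.filter fun p => p ∈ (fun q => ((ℝ ∙ EuclideanSpace.single (2 : Fin 3) (1 : ℝ)).reflection.trans M) q + t') ''
        fccStacking 1 (Real.sqrt (2 / 3))).filter fun x => x - M (triangularVec₁ 1) ∉ X).card : ℕ) : ℝ) +
      ((((X.filter fun p => p ∈ (fun q => ((ℝ ∙ EuclideanSpace.single (2 : Fin 3) (1 : ℝ)).reflection.trans M) q + t') ''
        fccStacking 1 (Real.sqrt (2 / 3))).filter fun x => x + M (triangularVec₂ 1) ∉ X).card : ℕ) : ℝ) +
      ((((X.filter fun p => p ∈ (fun q => ((ℝ ∙ EuclideanSpace.single (2 : Fin 3) (1 : ℝ)).reflection.trans M) q + t') ''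
        fccStacking 1 (Real.sqrt (2 / 3))).filter fun x => x - M (triangularVec₂ 1) ∉ X).card : ℕ) : ℝ) +
      ((((X.filter fun p => p ∈ (fun q => ((ℝ ∙ EuclideanSpace.single (2 : Fin 3) (1 : ℝ)).reflection.trans M) q + t') ''
        fccStacking 1 (Real.sqrt (2 / 3))).filter fun x => x + M (triangularVec₂ 1 - triangularVec₁ 1) ∉ X).card : ℕ) : ℝ) +
      ((((X.filter fun p => p ∈ (fun q => ((ℝ ∙ EuclideanSpace.single (2 : Fin 3) (1 : ℝ)).reflection.trans M) q + t') ''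
        fccStacking 1 (Real.sqrt (2 / 3))).filter fun x => x - M (triangularVec₂ 1 - triangularVec₁ 1) ∉ X).card : ℕ) : ℝ) +
      4 * ((∑ x ∈ (X.filter fun p => p ∈ (fun q => ((ℝ ∙ EuclideanSpace.single (2 : Fin 3) (1 : ℝ)).reflection.trans M) q + t') ''
        fccStacking 1 (Real.sqrt (2 / 3))), (X.filter fun y => dist x y = 1).card : ℕ) : ℝ) ≤
      ((X.filter fun p => p ∈ (fun q => ((ℝ ∙ EuclideanSpace.single (2 : Fin 3) (1 : ℝ)).reflection.trans M) q + t') ''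
        fccStacking 1 (Real.sqrt (2 / 3))).card : ℝ) * 48 := by
    exact_mod_cast hsum₂
  have hdegr : ((∑ x ∈ (X.filter fun p => p ∈ (fun q => M q + t) '' fccStacking 1 (Real.sqrt (2 / 3))), (X.filter fun y => dist x y = 1).card : ℕ) : ℝ) +
      ((∑ x ∈ (X.filter fun p => p ∈ (fun q => ((ℝ ∙ EuclideanSpace.single (2 : Fin 3) (1 : ℝ)).reflection.trans M) q + t') ''
        fccStacking 1 (Real.sqrt (2 / 3))), (X.filter fun y => dist x y = 1).card : ℕ) : ℝ) = (orderedContacts X : ℝ) := by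
    exact_mod_cast hdeg'
  have hcardr : ((X.filter fun p => p ∈ (fun q => M q + t) '' fccStacking 1 (Real.sqrt (2 / 3))).card : ℝ) + ((X.filter fun p => p ∈ (fun q => ((ℝ ∙ EuclideanSpace.single (2 : Fin 3) (1 : ℝ)).reflection.trans M) q + t') ''
        fccStacking 1 (Real.sqrt (2 / 3))).card : ℝ) = (X.card : ℝ) := by
    exact_mod_cast hcard
  linarith


/-- **The wall term of the rigid twin rung (disjoint grains).**  Under the crux's literal
co-axiality hypotheses for both grains with a TWIN word pair (`σ 0 ≠ σ' 0`), grains disjoint as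
point sets (no coincidence sites), for every unit packing `X ⊆ Λ₁ ∪ Λ₂` (RIGID) containing the two
complete clamped slabs of the stub's cell (`ρ ≥ R₀ ≥ 3`):

  `2 · (√6 · √(1 − ⟪L e₃, e₃⟫²) · πρ² − 3√2π(6R₀+16)(1+h)ρ) ≤ 8 · D(X)`,

i.e. `D(X) ≥ (√6/4) sin θ · πρ² − C(1+h)ρ` with `√6/4 = 0.61 ≥ ½` — the riser counts of both
grains (`coaxial_inPlane_vacancies`, `coaxial_inPlane_vacancies_top`) fed into the twin-pair
slot ledger.  (The stub also books the two outer faces; that bookkeeping is not in this file.) -/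
theorem coaxial_rigid_twin_wall_term
    (A₁ : EuclideanSpace ℝ (Fin 3) ≃ₗᵢ[ℝ] EuclideanSpace ℝ (Fin 3)) (t₁ : EuclideanSpace ℝ (Fin 3))
    (A₂ : EuclideanSpace ℝ (Fin 3) ≃ₗᵢ[ℝ] EuclideanSpace ℝ (Fin 3)) (t₂ : EuclideanSpace ℝ (Fin 3))
    (L : EuclideanSpace ℝ (Fin 3) ≃ₗᵢ[ℝ] EuclideanSpace ℝ (Fin 3)) (s₁ s₂ : EuclideanSpace ℝ (Fin 3))
    {σ σ' : ℤ → ℤ} (hσ : IsHaggSeq σ) (hσ' : IsHaggSeq σ') (htwin : σ 0 ≠ σ' 0)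
    (hsub₁ : (fun q => A₁ q + t₁) '' fccStacking 1 (Real.sqrt (2 / 3)) ⊆
      (fun p => L p + s₁) '' barlowStacking 1 (Real.sqrt (2 / 3)) σ)
    (hsub₂ : (fun q => A₂ q + t₂) '' fccStacking 1 (Real.sqrt (2 / 3)) ⊆
      (fun p => L p + s₂) '' barlowStacking 1 (Real.sqrt (2 / 3)) σ')
    (X : Finset (EuclideanSpace ℝ (Fin 3)))
    (hX : ∀ p ∈ X, ∀ q ∈ X, p ≠ q → 1 ≤ dist p q)
    (hrigid : ∀ p ∈ X, p ∈ (fun q => A₁ q + t₁) '' fccStacking 1 (Real.sqrt (2 / 3)) ∨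
      p ∈ (fun q => A₂ q + t₂) '' fccStacking 1 (Real.sqrt (2 / 3)))
    (R₀ h ρ : ℝ) (hR₀ : 3 ≤ R₀) (hh : 0 ≤ h) (hρ : R₀ ≤ ρ)
    (hP₁ : ∀ p ∈ (fun q => A₁ q + t₁) '' fccStacking 1 (Real.sqrt (2 / 3)),
      -(2 * R₀) ≤ p 2 → p 2 ≤ -R₀ → p 0 ^ 2 + p 1 ^ 2 ≤ ρ ^ 2 → p ∈ X)
    (hP₂ : ∀ p ∈ (fun q => A₂ q + t₂) '' fccStacking 1 (Real.sqrt (2 / 3)),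
      h + R₀ ≤ p 2 → p 2 ≤ h + 2 * R₀ → p 0 ^ 2 + p 1 ^ 2 ≤ ρ ^ 2 → p ∈ X)
    (hdisj : ∀ p ∈ (fun q => A₁ q + t₁) '' fccStacking 1 (Real.sqrt (2 / 3)),
      p ∉ (fun q => A₂ q + t₂) '' fccStacking 1 (Real.sqrt (2 / 3))) :
    2 * (Real.sqrt 6 * Real.sqrt (1 - ⟪L (EuclideanSpace.single (2 : Fin 3) (1 : ℝ)),
        EuclideanSpace.single (2 : Fin 3) (1 : ℝ)⟫_ℝ ^ 2) * Real.pi * ρ ^ 2 -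
        3 * (Real.sqrt 2 * Real.pi * (6 * R₀ + 16) * (1 + h) * ρ)) ≤ 8 * contactDeficiency X := by
  classical
  have r₁ := coaxial_inPlane_vacancies A₁ t₁ A₂ t₂ L s₁ hσ hsub₁ X hX R₀ h ρ hR₀ hh hρ hP₁ hP₂ hdisj
  have r₂ := coaxial_inPlane_vacancies_top A₁ t₁ A₂ t₂ L s₂ hσ' hsub₂ X hX R₀ h ρ hR₀ hh hρ hP₁ hP₂
    hdisj
  rcases hσ 0 with h1 | hm1
  · -- grain 1 in the fcc word, grain 2 in the twin word
    have hm1' : σ' 0 = -1 := (hσ' 0).resolve_left fun h' => htwin (h1.trans h'.symm)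
    have e₁ := coaxial_frame_eq_fcc_of_one A₁ t₁ L s₁ hσ hsub₁ h1
    have e₂ := (coaxial_frame_eq_fcc_of_neg_one A₂ t₂ L s₂ hσ' hsub₂ hm1').1
    simp only [e₁, e₂] at r₁ r₂ hrigid hdisj
    have key := twin_inPlane_vacancies_le_eight_deficiency L s₁ s₂ X hX hrigid hdisj
    linarith
  · -- grain 1 in the twin word, grain 2 in the fcc word
    have h1' : σ' 0 = 1 := (hσ' 0).resolve_right fun h' => htwin (hm1.trans h'.symm)
    have e₁ := (coaxial_frame_eq_fcc_of_neg_one A₁ t₁ L s₁ hσ hsub₁ hm1).1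
    have e₂ := coaxial_frame_eq_fcc_of_one A₂ t₂ L s₂ hσ' hsub₂ h1'
    simp only [e₁, e₂] at r₁ r₂ hrigid hdisj
    have key := twin_inPlane_vacancies_le_eight_deficiency L s₂ s₁ X hX
      (fun p hp => (hrigid p hp).symm) (fun p hp hp' => hdisj p hp' hp)
    linarith

end Summit.Ventures.Crystal3D.Theorems

end
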